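import Mathlib
import HarnessLib

/-!
# Block-diagonal determinant: `det f = det (f|p) · det (f|q)` for complementary invariant subspaces

Family `hodge`, layer `Literature/AlgebraicGeometry/HodgeTheory`. A pure linear-algebra helper:
if an endomorphism `f` of a finite-dimensional complex vector space `V` preserves two
complementary subspaces `p`, `q` (`IsCompl p q`, i.e. `V = p ⊕ q`), then
`det f = det (f|p) * det (f|q)` (`det_eq_det_restrict_mul_det_restrict`): in a basis adapted to
the decomposition the matrix of `f` is block-diagonal. Proof: transport `f` along the linear
equivalence `p × q ≃ₗ V` (`Submodule.prodEquivOfIsCompl`), where it becomes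
`(f|p).prodMap (f|q)`, and use invariance of the determinant under conjugation
(`LinearMap.det_conj`) together with `LinearMap.det_prodMap`.

It is used for the flatness of the Weil lines in the anchoring family for Weil classes: the
monodromy `γ` on `H¹ = V₊ ⊕ V₋` (eigenspaces of the `√-p`-action) has
`det γ = det (γ|V₊) · det (γ|V₋)`, the first step of "level-`n` structure forces special unitary
monodromy" (van Geemen, 5.8–5.11).

## References

* [vanGeemen1994HodgeAV] B. van Geemen, An introduction to the Hodge conjecture for abelian
  varieties, in: Algebraic Cycles and Hodge Theory (Torino 1993), LNM 1594, Springer 1994, 5.8–5.11.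
-/

namespace Literature.AlgebraicGeometry.HodgeTheory

variable {V : Type*} [AddCommGroup V] [Module ℂ V] [FiniteDimensional ℂ V]

/-- **Block-diagonal determinant formula.** If an endomorphism `f` of a finite-dimensional
complex vector space preserves two complementary subspaces `p` and `q` (`V = p ⊕ q`), then
`det f = det (f|p) * det (f|q)`: conjugating by `p × q ≃ₗ V` turns `f` into the block-diagonal
map `(f|p).prodMap (f|q)`, whose determinant is the product of the blocks. [folklore] -/
theorem det_eq_det_restrict_mul_det_restrict {p q : Submodule ℂ V} (hpq : IsCompl p q)
    (f : Module.End ℂ V) (hp : ∀ v ∈ p, f v ∈ p) (hq : ∀ v ∈ q, f v ∈ q) :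
    LinearMap.det f = LinearMap.det (f.restrict hp) * LinearMap.det (f.restrict hq) := by
  set e : (p × q) ≃ₗ[ℂ] V := Submodule.prodEquivOfIsCompl p q hpq
  have key : (e.symm : V →ₗ[ℂ] (p × q)) ∘ₗ f ∘ₗ (e : (p × q) →ₗ[ℂ] V) =
      (f.restrict hp).prodMap (f.restrict hq) := by
    refine LinearMap.ext fun x => ?_
    simp only [LinearMap.coe_comp, Function.comp_apply, LinearEquiv.coe_coe]
    rw [LinearEquiv.symm_apply_eq]
    simp only [LinearMap.prodMap_apply, e, Submodule.coe_prodEquivOfIsCompl', map_add,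
      LinearMap.coe_restrict_apply]
  rw [← LinearMap.det_conj f e.symm, LinearEquiv.symm_symm, key, LinearMap.det_prodMap]

end Literature.AlgebraicGeometry.HodgeTheory
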